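import Summits.QuantumFields.YangMills.Theorems.PoincareLipschitzSobolevBadBondEnergy
import Summits.QuantumFields.YangMills.Theorems.PoincareLipschitzSobolevCellTranslationSumClosed
import HarnessLib

/-!
# Crux `HistoryTailL` (stmt-QuantumFields-19936), road R1 (LINE 25 `CompactnessTransfer`, S2♭″ brick (Γ5-C), part 3) — THE DOOR `hC`:
# the (Γ5-KNIT)'s displayed hypothesis `hC` (px5 g8 `KNIT-hC.text` 2095d11b) discharged VERBATIM from ✓`bad_part_small`, via px15's adapter
# (α) «`IntegrableOn dens` ⇒ every `GV·v ∈ L²(Q)`»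

Cell `ym3-torus` (rung R3 = continuum SU(2) Yang–Mills on T³ — a RUNG, NOT the Clay problem); TWIN-WIDTH helper seat `ym-ust-19936-w7` g13 (LEAD
★w1-19936 g10 S2♭″ architecture; Γ5 pens of record 13:02Z: (Γ5-C) = w7; knit = px5 g8 `…SobolevSamplingConsistency.exists_unit_sample_of_sobolev (hB) (hC) (hD)`).
Helper `--supports stmt-QuantumFields-19936`; THEOREMS ONLY (0 `def`, 0 `sorry`, default heartbeats).  Imports ✓w7 part 2 `…SobolevBadBondEnergy`
(`bad_part_small`) and ✓px15 g6 FILE F `…SobolevCellTranslationSumClosed` (the adapter (α) `memLp_two_apply_of_integrableOn_dens`: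
`IntegrableOn dens` ⇒ every `GV·v ∈ L²(Q)` — imported by name, not re-derived; px14 g6 13:36:06Z dedup alert №2).
WHAT IS PROVED (ns `…Theorems.PoincareLipschitzSobolevBadPart`): ★★★`hC_holds` — px5 g8's displayed `hC` CHARACTER FOR CHARACTER (1074∕1074 ws-normalised;
the `κ < 1` row is carried and unused).
HONEST SCOPE.  The `hC` door of (Γ5) only; `hB` (px15 F), `hD` (w4 g15) and the knit (px5 g8) are separate files; S2♭″, S1″-band, `hHalvingBand`, K1,
`MeanDeviationL`, `BlockLipschitzL`, `HistoryTailL` are NOT proved here; rung R3, not Clay; YM gap NOT proved; no summit statement is proved here.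
Refs: Hardt–Kinderlehrer–Lin, CMP 105 (1986) 547–570 [HardtKinderlehrerLin1986]; Evans, PDE (2010) §5.2, §5.8.
-/

set_option autoImplicit false

noncomputable section

open MeasureTheory Set Finset
open scoped BigOperators NNReal ENNReal

namespace Summit.QuantumFields.YangMills.Theorems.PoincareLipschitzSobolevBadPart

open Literature.Analysis.FunctionSpaces
open Literature.MathematicalPhysics.QuantumFieldTheory.Balaban1983to89
open B4Eq19LatticeOperators (Zd box unitVec)
open Summit.QuantumFields.YangMills.Theorems.PoincareLipschitzSamplingCells (isOpen_absCube)
open Summit.QuantumFields.YangMills.Theorems.PoincareLipschitzSobolevBadBondEnergy (bad_part_small)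
open Summit.QuantumFields.YangMills.Theorems.PoincareLipschitzSobolevCellTranslationSumClosed (memLp_two_apply_of_integrableOn_dens)

/-- ★★★ **THE DOOR `hC` OF THE (Γ5-KNIT), VERBATIM** (px5 g8 `KNIT-hC.text.px5g8.txt` sha16 2095d11b = w7 g13 13:02Z interface): for a weakly differentiable
unit-sphere-valued `V` on the open unit cube with integrable `dens`, and `0 < κ < 1`, `0 < s < 1`, `ε > 0`, beyond some `R₀` the cell averages
`a y = R³•∫_{cell_y}V` have bad-bond energy `≤ R·ε` on `box 0 ⌊sR⌋` and `≤ ε·R³` bad sites in `box 0 (⌊sR⌋+1)`. [cite: HardtKinderlehrerLin1986, §2] -/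
theorem hC_holds : ∀ (hQ : IsOpen {x : EuclideanSpace ℝ (Fin 3) | ∀ i : Fin 3, |x i| < 1})
      (V : EuclideanSpace ℝ (Fin 3) → EuclideanSpace ℝ (Fin 4)) (GV : EuclideanSpace ℝ (Fin 3) → (EuclideanSpace ℝ (Fin 3) →L[ℝ] EuclideanSpace ℝ (Fin 4))),
      HasWeakFDerivOn ⟨{x : EuclideanSpace ℝ (Fin 3) | ∀ i : Fin 3, |x i| < 1}, hQ⟩ volume V GV →
      (∀ x : EuclideanSpace ℝ (Fin 3), (∀ i : Fin 3, |x i| < 1) → ‖V x‖ = 1) →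
      IntegrableOn (fun x => ∑ i : Fin 3, ‖GV x (EuclideanSpace.single i (1:ℝ))‖ ^ 2) {x : EuclideanSpace ℝ (Fin 3) | ∀ i : Fin 3, |x i| < 1} volume →
      ∀ (κ s ε : ℝ), 0 < κ → κ < 1 → 0 < s → s < 1 → 0 < ε → ∃ R₀ : ℕ, ∀ R : ℕ, R₀ ≤ R →
      ∀ (a : Zd 3 → EuclideanSpace ℝ (Fin 4)),
        (∀ y, a y = ((R : ℝ) ^ 3) • ∫ x in {x : EuclideanSpace ℝ (Fin 3) | ∀ i, (y i : ℝ) / R < x i ∧ x i < ((y i : ℝ) + 1) / R}, V x) →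
        (R : ℝ)⁻¹ * (∑ e ∈ (box (0 : Zd 3) ⌊s * R⌋ ×ˢ (Finset.univ : Finset (Fin 3))) with
            (‖a e.1‖ ^ 2 < 1 - κ ∨ ‖a (e.1 + unitVec e.2)‖ ^ 2 < 1 - κ), ‖a (e.1 + unitVec e.2) - a e.1‖ ^ 2) ≤ ε ∧
        ((R : ℝ)⁻¹) ^ 3 * (((box (0 : Zd 3) (⌊s * R⌋ + 1)).filter (fun y => ‖a y‖ ^ 2 < 1 - κ)).card : ℝ) ≤ ε := by
  intro hQ V GV hGV hV1 hdens κ s ε hκ _hκ1 hs hs1 hε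
  have hGV2 := memLp_two_apply_of_integrableOn_dens hQ hGV hdens
  exact bad_part_small V GV hGV hV1 hGV2 hκ hs hs1 hε

end Summit.QuantumFields.YangMills.Theorems.PoincareLipschitzSobolevBadPart

end
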